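import Literature.NumberTheory.Sieve.BombieriFriedlanderIwaniec
import HarnessLib

/-!
# Bombieri–Friedlander–Iwaniec 1986: the dispersion sums and Theorems 1, 2, 5, 5*

Trunk `AntSieve`, companion to `Literature.NumberTheory.Sieve.BombieriFriedlanderIwaniec`.  That file
vendors Theorem 10 of E. Bombieri, J. B. Friedlander, H. Iwaniec, *Primes in arithmetic progressions
to large moduli*, Acta Math. 156 (1986), 203–251 (`Literature.NumberTheory.Sieve.BombieriFriedlanderIwaniecTheorem10`, the
printed leaf under `Literature.NumberTheory.Sieve.bfi_wellFactorable_level`).  In the source, Theorem 10 is DERIVED (§17,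
p. 249) from three mean-value theorems for bilinear forms over factorable moduli — Theorems 1 (§8),
2 (§9) and 5* (§12) — through the machinery of §15.  This file is the next layer of that DAG: it
defines the objects of BFI §3 and vendors Theorems 1, 2, 5 and 5* as named facts (D-0014), with
the quantifier structure that BFI's conventions on `ε` and `B` leave implicit made explicit (see
"Faithfulness" below), and PROVES the one-line reduction `𝒟² ≤ ‖δ‖² ‖α‖² 𝒢` of p. 214.

## Contents

* `Literature.BFI.dyadic M` — the range `m ∼ M`, i.e. `M < m ≤ 2M` (BFI, Notations, p. 203).
* `Literature.BFI.l2Sq N β = ∑_{n ∼ N} β_n²` (`‖β‖²`).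
* `Literature.BFI.dispD a M N Q R α β γ δ` — the dispersion sum `𝒟(M, N, Q, R)` of (3.1), p. 214:
  `∑_{q∼Q, r∼R, (qr,a)=1} γ_q δ_r ( ∑_{m∼M, n∼N, mn ≡ a (qr)} α_m β_n − φ(qr)⁻¹ ∑_{(mn,qr)=1} α_m β_n )`.
* `Literature.BFI.dispG a M N Q R β γ` — the sum `𝒢(M, N, Q, R)` of p. 214 (the left side of (3.3)):
  `∑_{r∼R, m∼M, (r,am)=1} { ∑_{q∼Q, (q,am)=1} γ_q ( ∑_{n∼N, mn≡a(qr)} β_n − φ(qr)⁻¹ ∑_{(n,qr)=1} β_n ) }²`.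
* `Literature.NumberTheory.Sieve.BFI.dispD_sq_le` (PROVED): `𝒟² ≤ (∑_{r∼R} δ_r²)(∑_{m∼M} α_m²) 𝒢` ("By Cauchy's inequality we
  obtain", p. 214), for arbitrary real coefficients.
* `Literature.BFI.SiegelWalfiszHyp N B C β` — hypothesis (A₂) of §1 (p. 206) for `β` at scale `N`, with the
  divisor exponent `B` and the implied constants `C : ℝ → ℝ` (one for each exponent `A`) explicit.
* `Literature.BFI.IsSifted S N₀ β` — hypothesis (A₄) (p. 220): `β_n = 0` for `n ∈ S` with a prime factor `≤ N₀`.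
* `Literature.BFI.roughIndicator z` — the coefficients (A₆*) (p. 237): `1` if `m` has no prime factor `< z`,
  `0` otherwise.
* Named facts `Literature.NumberTheory.Sieve.BombieriFriedlanderIwaniecTheorem1`, `…Theorem2` (conclusion (3.3) for `𝒢`),
  `…Theorem5` (conclusion (12.4) for `𝒟` with `α ≡ 1`), `…Theorem5Star` (sifted `α`).
* PROVED corollaries `…Theorem1.dispD_sq_bound`, `…Theorem2.dispD_sq_bound`: the `𝒟`-form
  `𝒟² ≤ ∑δ² ∑α² · C ‖β‖² x R⁻¹ ℒ^{−A}` that §§15–17 consume.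

## Faithfulness (source read: Acta Math. 156, Notations p. 203–204, §1 pp. 205–206, §3 p. 214,
§6 p. 220, §8 p. 225, §9 pp. 229–230, §12 pp. 235–239; store key `paper:galaxy-pdf-3167048108437833940`)

* BFI, Notations (p. 204): "Any statement including `ε` is meant simply as the claim that the statement
  is true for all sufficiently small positive `ε`"; "`B` — some sufficiently large, positive constant,
  not necessarily the same in each occurrence".  We render every theorem as `∀ ε > 0` where a larger
  `ε` only weakens the claim (Theorems 1, 2: `ε` enters only the ranges), and otherwise existentially:
  the saving exponent of Theorem 5 is `∃ ε' > 0` (the print writes the same letter `ε` in (12.4) and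
  (12.5)); the exponent of `ℒ` in `N₀ = ℒ^{A+B}` of (A₄) ((6.5), p. 220) is `∃ B₀`; the exponent in
  (A₅) (p. 229: `N^{1−ε} ∑|β_n|⁴ ≪ (∑|β_n|²)²`) is `∃ ε₅ > 0` chosen after all data of Theorem 2.  Each of
  these choices makes our statement WEAKER than (implied by) any admissible literal reading.
* "(A₂) … with some `B > 0` and any `A > 0`, the constant implied in `≪` depending on `A` alone"
  (p. 206): `β` ranges over sequences obeying the Siegel–Walfisz bounds with a fixed exponent `B` and a
  fixed family of constants `C(A)`; the theorems' constants may depend on `B` and on the whole family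
  `C` (they are quantified before `∃ C'`).  The residue `l` in (A₂) is any integer coprime to `k` (the
  print adds "`l ≠ 0`", which does not change the set of classes).
* (A₁) (p. 206): `M = x^{1−ϑ}`, `N = x^ϑ`, `ε ≤ ϑ ≤ 1 − ε`, rendered `M N = x`, `x^ε ≤ N ≤ x^{1−ε}`.
  (A₃) (p. 214): `|γ_q| ≤ τ(q)^B`, `|δ_r| ≤ τ(r)^B`, `QR < x`.  We add `1/2 ≤ Q`, `1/2 ≤ R` (so that
  `q ∼ Q`, `r ∼ R` range over moduli `≥ 1`; `Q = 1/2` is the block `q = 1`), a restriction.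
* Coefficients are real-valued here (the print allows complex `β`); real sequences are all that the
  application to primes (§§15–17: convolutions of `μ` and `1`) uses, and the restriction weakens the
  vendored statements.
* Theorem 5* (p. 238–239: "Theorem 5 holds if (A₆) is replaced by (A₆*) subject to
  `z ≤ z₀ = exp(log x / log log x)`").  The proof displayed on p. 238 bounds the sieved main part by
  (12.4) and the fundamental-lemma remainder by `Δ(M,N;q) ≪ ℒ^{−A} Q^{−1} M ∑ β_n` "which is
  admissible", i.e. with a saving `ℒ^{−A}` (any `A`), not `x^{−ε}`.  We therefore vendor Theorem 5*
  with the conclusion `|𝒟| ≤ C ‖β‖ x^{1/2} M^{1/2} ℒ^{−A}` for every `A > 0` — exactly what p. 238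
  proves and what §§15–17 use — which is weaker than the literal "(12.4)".
* Not vendored here: Theorems 3, 4, 6, 7, 7* (not used for Theorem 10), Theorem 0 and Lemmas 1–2
  (inputs to the proofs of Theorems 1–5*, one layer further down), Lemma 3 (see
  `Literature.NumberTheory.Sieve.ShiuBrunTitchmarsh`), Lemma 5 (PROVED in
  `Literature.NumberTheory.Sieve.HeathBrownIdentity`).

## References

* E. Bombieri, J. B. Friedlander, H. Iwaniec, *Primes in arithmetic progressions to large moduli*,
  Acta Math. 156 (1986), 203–251. [BombieriFriedlanderIwaniecActa1986]
-/

open Finset Real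
open scoped ArithmeticFunction.sigma

namespace Literature.NumberTheory.Sieve

namespace BFI

/-! ### Dyadic ranges and norms -/

/-- `m ∼ M`: the finite set of natural numbers `m` with `M < m ≤ 2M` (BFI 1986, Notations, p. 203:
"`m ∼ M` means `M < m ≤ 2M`").  [cite: BombieriFriedlanderIwaniecActa1986, Notations p. 203] -/
noncomputable def dyadic (M : ℝ) : Finset ℕ :=
  (Finset.range (⌊2 * M⌋₊ + 1)).filter fun m : ℕ => M < m

/-- Membership in `m ∼ M` for `M ≥ 0`: `M < m ≤ 2M`. [folklore] -/
theorem mem_dyadic {M : ℝ} (hM : 0 ≤ M) {m : ℕ} : m ∈ dyadic M ↔ M < m ∧ (m : ℝ) ≤ 2 * M := by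
  simp only [dyadic, mem_filter, mem_range, Nat.lt_add_one_iff, Nat.le_floor_iff (by linarith : 0 ≤ 2 * M)]
  tauto

/-- Elements of `m ∼ M` are positive when `M ≥ 0`. [folklore] -/
theorem pos_of_mem_dyadic {M : ℝ} (hM : 0 ≤ M) {m : ℕ} (hm : m ∈ dyadic M) : 0 < m := by
  have h := ((mem_dyadic hM).1 hm).1
  exact_mod_cast hM.trans_lt h

/-- `‖β‖² = ∑_{n ∼ N} β_n²`, the square of the `ℓ²`-norm over the dyadic range (BFI, Notations,
p. 203). [cite: BombieriFriedlanderIwaniecActa1986, Notations p. 203] -/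
noncomputable def l2Sq (N : ℝ) (β : ℕ → ℝ) : ℝ :=
  ∑ n ∈ dyadic N, β n ^ 2

/-- `‖β‖² ≥ 0`. [folklore] -/
theorem l2Sq_nonneg (N : ℝ) (β : ℕ → ℝ) : 0 ≤ l2Sq N β :=
  sum_nonneg fun _ _ => sq_nonneg _

/-! ### The sums `𝒟` and `𝒢` of BFI §3 -/

/-- The dispersion sum `𝒟(M, N, Q, R)` of BFI (3.1), p. 214, for the residue `a`, real coefficients
`α_m` (`m ∼ M`), `β_n` (`n ∼ N`), `γ_q` (`q ∼ Q`), `δ_r` (`r ∼ R`):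
`𝒟 = ∑_{q ∼ Q} ∑_{r ∼ R, (qr, a) = 1} γ_q δ_r ( ∑_{m ∼ M, n ∼ N, mn ≡ a (mod qr)} α_m β_n
  − φ(qr)⁻¹ ∑_{m ∼ M, n ∼ N, (mn, qr) = 1} α_m β_n )`.
[cite: BombieriFriedlanderIwaniecActa1986, §3 (3.1) p. 214] -/
noncomputable def dispD (a : ℤ) (M N Q R : ℝ) (α β γ δ : ℕ → ℝ) : ℝ :=
  ∑ q ∈ dyadic Q, ∑ r ∈ dyadic R,
    if IsCoprime ((q * r : ℕ) : ℤ) a then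
      γ q * δ r *
        ((∑ m ∈ dyadic M, ∑ n ∈ dyadic N,
            if ((m * n : ℕ) : ZMod (q * r)) = (a : ZMod (q * r)) then α m * β n else 0) -
          (∑ m ∈ dyadic M, ∑ n ∈ dyadic N,
            if (m * n).Coprime (q * r) then α m * β n else 0) / (Nat.totient (q * r) : ℝ))
    else 0

/-- The inner discrepancy of `𝒢` (p. 214) at the modulus `d` for fixed `m`:
`∑_{n ∼ N, mn ≡ a (mod d)} β_n − φ(d)⁻¹ ∑_{n ∼ N, (n, d) = 1} β_n`.
[cite: BombieriFriedlanderIwaniecActa1986, §3 p. 214] -/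
noncomputable def innerDisc (a : ℤ) (N : ℝ) (β : ℕ → ℝ) (d m : ℕ) : ℝ :=
  (∑ n ∈ dyadic N, if ((m * n : ℕ) : ZMod d) = (a : ZMod d) then β n else 0) -
    (∑ n ∈ dyadic N, if n.Coprime d then β n else 0) / (Nat.totient d : ℝ)

/-- The `q`-sum inside the braces of `𝒢` (p. 214) for fixed `r ∼ R`, `m ∼ M`:
`∑_{q ∼ Q, (q, am) = 1} γ_q ( ∑_{n ∼ N, mn ≡ a (qr)} β_n − φ(qr)⁻¹ ∑_{(n, qr) = 1} β_n )`.
[cite: BombieriFriedlanderIwaniecActa1986, §3 p. 214] -/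
noncomputable def braceSum (a : ℤ) (N Q : ℝ) (β γ : ℕ → ℝ) (r m : ℕ) : ℝ :=
  ∑ q ∈ dyadic Q, if IsCoprime (q : ℤ) (a * m) then γ q * innerDisc a N β (q * r) m else 0

/-- The sum `𝒢(M, N, Q, R)` of BFI p. 214 (whose bound is (3.3)):
`𝒢 = ∑_{r ∼ R} ∑_{m ∼ M, (r, am) = 1} { ∑_{q ∼ Q, (q, am) = 1} γ_q ( ∑_{n ∼ N, mn ≡ a (qr)} β_n
  − φ(qr)⁻¹ ∑_{n ∼ N, (n, qr) = 1} β_n ) }²`.  It involves neither `α` nor `δ`.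
[cite: BombieriFriedlanderIwaniecActa1986, §3 p. 214] -/
noncomputable def dispG (a : ℤ) (M N Q R : ℝ) (β γ : ℕ → ℝ) : ℝ :=
  ∑ r ∈ dyadic R, ∑ m ∈ dyadic M,
    if IsCoprime (r : ℤ) (a * m) then braceSum a N Q β γ r m ^ 2 else 0

/-- `𝒢 ≥ 0` (a sum of squares). [folklore] -/
theorem dispG_nonneg (a : ℤ) (M N Q R : ℝ) (β γ : ℕ → ℝ) : 0 ≤ dispG a M N Q R β γ :=
  sum_nonneg fun _ _ => sum_nonneg fun _ _ => by split_ifs <;> positivity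

/-! ### `𝒟² ≤ ‖δ‖² ‖α‖² 𝒢` (BFI p. 214, "By Cauchy's inequality we obtain") -/

/-- If `(d, a) = 1` and `mn ≡ a (mod d)` then `(d, m) = 1`: a common prime factor of `d` and `m`
would divide `a`. [folklore] -/
theorem coprime_of_natCast_mul_eq {d m n : ℕ} {a : ℤ} (h : IsCoprime (d : ℤ) a)
    (hmn : ((m * n : ℕ) : ZMod d) = (a : ZMod d)) : d.Coprime m := by
  have hmn' : (((m * n : ℕ) : ℤ) : ZMod d) = (a : ZMod d) := by rwa [Int.cast_natCast]
  obtain ⟨k, hk⟩ := (ZMod.intCast_eq_intCast_iff_dvd_sub _ _ _).1 hmn'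
  have hcop : IsCoprime (d : ℤ) ((m * n : ℕ) : ℤ) := by
    have : ((m * n : ℕ) : ℤ) = a + (-k) * (d : ℤ) := by linear_combination -hk
    rw [this]
    exact h.add_mul_right_right _
  rw [Nat.cast_mul] at hcop
  exact Nat.isCoprime_iff_coprime.1 hcop.of_mul_right_left

/-- Rearrangement of `𝒟` (p. 214): the terms of (3.1) with `(qr, m) > 1` vanish (the congruence
`mn ≡ a (qr)` is then insoluble as `(qr, a) = 1`, and `(mn, qr) > 1`), so
`𝒟 = ∑_{r ∼ R} ∑_{m ∼ M, (r, am) = 1} δ_r α_m {∑_{q ∼ Q, (q, am) = 1} γ_q (…)}`, the brace being the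
one of `𝒢`. [cite: BombieriFriedlanderIwaniecActa1986, §3 p. 214] -/
theorem dispD_eq_sum_braceSum (a : ℤ) (M N Q R : ℝ) (α β γ δ : ℕ → ℝ) :
    dispD a M N Q R α β γ δ =
      ∑ r ∈ dyadic R, ∑ m ∈ dyadic M,
        δ r * α m * (if IsCoprime (r : ℤ) (a * m) then braceSum a N Q β γ r m else 0) := by
  -- the summand of the triple sum `∑_q ∑_r ∑_m`
  set G : ℕ → ℕ → ℕ → ℝ := fun q r m =>
    δ r * α m * (if IsCoprime (r : ℤ) (a * m) then
      (if IsCoprime (q : ℤ) (a * m) then γ q * innerDisc a N β (q * r) m else 0) else 0) with hG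
  have hR : ∀ r ∈ dyadic R, ∀ m ∈ dyadic M,
      δ r * α m * (if IsCoprime (r : ℤ) (a * m) then braceSum a N Q β γ r m else 0) =
        ∑ q ∈ dyadic Q, G q r m := by
    intro r _ m _
    simp only [hG, braceSum]
    split_ifs with h
    · rw [Finset.mul_sum]
    · simp
  rw [Finset.sum_congr rfl fun r hr => Finset.sum_congr rfl fun m hm => hR r hr m hm]
  rw [Finset.sum_congr rfl fun r _ => Finset.sum_comm, Finset.sum_comm]
  unfold dispD
  refine Finset.sum_congr rfl fun q _ => Finset.sum_congr rfl fun r _ => ?_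
  -- per `(q, r)`:
  by_cases hqa : IsCoprime ((q * r : ℕ) : ℤ) a
  · rw [if_pos hqa]
    -- distribute `α_m` and the sums over `m`
    have hdist : ∀ (P : ℕ → ℕ → Prop) [∀ m n, Decidable (P m n)],
        (∑ m ∈ dyadic M, ∑ n ∈ dyadic N, if P m n then α m * β n else 0) =
          ∑ m ∈ dyadic M, α m * ∑ n ∈ dyadic N, if P m n then β n else 0 := by
      intro P _
      refine Finset.sum_congr rfl fun m _ => ?_
      rw [Finset.mul_sum]
      refine Finset.sum_congr rfl fun n _ => ?_
      split_ifs <;> simp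
    rw [hdist, hdist, Finset.sum_div, ← Finset.sum_sub_distrib, Finset.mul_sum]
    refine Finset.sum_congr rfl fun m _ => ?_
    simp only [hG, innerDisc]
    have hqr : ((q * r : ℕ) : ℤ) = (q : ℤ) * (r : ℤ) := by push_cast; ring
    by_cases hm : IsCoprime ((q * r : ℕ) : ℤ) (m : ℤ)
    · -- `(qr, am) = 1`: the two main terms agree
      have hram : IsCoprime (r : ℤ) (a * m) :=
        IsCoprime.mul_right (IsCoprime.of_mul_left_right (hqr ▸ hqa))
          (IsCoprime.of_mul_left_right (hqr ▸ hm))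
      have hqam : IsCoprime (q : ℤ) (a * m) :=
        IsCoprime.mul_right (IsCoprime.of_mul_left_left (hqr ▸ hqa))
          (IsCoprime.of_mul_left_left (hqr ▸ hm))
      rw [if_pos hram, if_pos hqam]
      have hmcop : (q * r).Coprime m := Nat.isCoprime_iff_coprime.1 hm
      have hB : (∑ n ∈ dyadic N, if (m * n).Coprime (q * r) then β n else 0) =
          ∑ n ∈ dyadic N, if n.Coprime (q * r) then β n else 0 := by
        refine Finset.sum_congr rfl fun n _ => ?_
        have : (m * n).Coprime (q * r) ↔ n.Coprime (q * r) :=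
          ⟨fun h => Nat.Coprime.coprime_mul_left h, fun h => Nat.Coprime.mul_left hmcop.symm h⟩
        simp only [this]
      rw [hB]
      ring
    · -- `(qr, m) > 1`: both the congruence sum and the coprimality sum vanish
      have hA : (∑ n ∈ dyadic N,
          if ((m * n : ℕ) : ZMod (q * r)) = (a : ZMod (q * r)) then β n else 0) = 0 := by
        refine Finset.sum_eq_zero fun n _ => ?_
        rw [if_neg]
        intro hmn
        exact hm (Nat.isCoprime_iff_coprime.2 (coprime_of_natCast_mul_eq hqa hmn))
      have hB : (∑ n ∈ dyadic N, if (m * n).Coprime (q * r) then β n else 0) = 0 := by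
        refine Finset.sum_eq_zero fun n _ => ?_
        rw [if_neg]
        intro hmn
        exact hm (Nat.isCoprime_iff_coprime.2 (Nat.Coprime.coprime_mul_right hmn).symm)
      rw [hA, hB]
      have hnot : ¬ (IsCoprime (r : ℤ) (a * m) ∧ IsCoprime (q : ℤ) (a * m)) := by
        rintro ⟨h1, h2⟩
        apply hm
        rw [hqr]
        exact IsCoprime.mul_left h2.of_mul_right_right h1.of_mul_right_right
      by_cases h1 : IsCoprime (r : ℤ) (a * m)
      · have h2 : ¬ IsCoprime (q : ℤ) (a * m) := fun h2 => hnot ⟨h1, h2⟩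
        rw [if_pos h1, if_neg h2]; ring
      · rw [if_neg h1]; ring
  · rw [if_neg hqa]
    symm
    refine Finset.sum_eq_zero fun m _ => ?_
    simp only [hG]
    have hqr : ((q * r : ℕ) : ℤ) = (q : ℤ) * (r : ℤ) := by push_cast; ring
    by_cases h1 : IsCoprime (r : ℤ) (a * m)
    · have h2 : ¬ IsCoprime (q : ℤ) (a * m) := by
        intro h2
        apply hqa
        rw [hqr]
        exact IsCoprime.mul_left h2.of_mul_right_left h1.of_mul_right_left
      rw [if_pos h1, if_neg h2]; ring
    · rw [if_neg h1]; ring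

/-- **`𝒟² ≤ ‖δ‖² ‖α‖² 𝒢`** (BFI p. 214: "By Cauchy's inequality we obtain
`𝒟²(M,N,Q,R) ≤ ‖δ‖² ‖α‖² 𝒢(M,N,Q,R)`"), for arbitrary real coefficients; here
`‖δ‖² = ∑_{r ∼ R} δ_r²`, `‖α‖² = ∑_{m ∼ M} α_m²`.  PROVED (rearrangement `dispD_eq_sum_braceSum` and the
Cauchy–Schwarz inequality over the pairs `(r, m)`).
[cite: BombieriFriedlanderIwaniecActa1986, §3 p. 214] -/
theorem dispD_sq_le (a : ℤ) (M N Q R : ℝ) (α β γ δ : ℕ → ℝ) :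
    dispD a M N Q R α β γ δ ^ 2 ≤
      (∑ r ∈ dyadic R, δ r ^ 2) * (∑ m ∈ dyadic M, α m ^ 2) * dispG a M N Q R β γ := by
  rw [dispD_eq_sum_braceSum]
  set v : ℕ → ℕ → ℝ := fun r m =>
    if IsCoprime (r : ℤ) (a * m) then braceSum a N Q β γ r m else 0 with hv
  have hD : (∑ r ∈ dyadic R, ∑ m ∈ dyadic M, δ r * α m * v r m) =
      ∑ p ∈ dyadic R ×ˢ dyadic M, (δ p.1 * α p.2) * v p.1 p.2 := by
    rw [Finset.sum_product]
  have hG : dispG a M N Q R β γ = ∑ p ∈ dyadic R ×ˢ dyadic M, v p.1 p.2 ^ 2 := by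
    rw [dispG, Finset.sum_product]
    refine Finset.sum_congr rfl fun r _ => Finset.sum_congr rfl fun m _ => ?_
    simp only [hv]
    split_ifs <;> simp
  have hN : (∑ r ∈ dyadic R, δ r ^ 2) * (∑ m ∈ dyadic M, α m ^ 2) =
      ∑ p ∈ dyadic R ×ˢ dyadic M, (δ p.1 * α p.2) ^ 2 := by
    rw [Finset.sum_product, Finset.sum_mul_sum]
    refine Finset.sum_congr rfl fun r _ => Finset.sum_congr rfl fun m _ => ?_
    ring
  rw [hD, hG, hN]
  exact Finset.sum_mul_sq_le_sq_mul_sq _ _ _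

/-! ### The hypotheses (A₂), (A₄), (A₆*) -/

/-- Hypothesis **(A₂)** of BFI §1 (p. 206) for the sequence `β` at scale `N` ("`β` is well
distributed in arithmetic progressions to small moduli"), with the divisor exponent `B` and the
implied constants `C A` explicit: for every `A > 0`, all `d, k ≥ 1` and every integer `l` coprime
to `k`,
`|∑_{n ∼ N, n ≡ l (k), (n, d) = 1} β_n − φ(k)⁻¹ ∑_{n ∼ N, (n, dk) = 1} β_n| ≤ C(A) ‖β‖ N^{1/2} τ(d)^B (log 2N)^{−A}`.
[cite: BombieriFriedlanderIwaniecActa1986, §1 (A₂) p. 206] -/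
def SiegelWalfiszHyp (N : ℝ) (B : ℝ) (C : ℝ → ℝ) (β : ℕ → ℝ) : Prop :=
  ∀ A : ℝ, 0 < A → ∀ d k : ℕ, 1 ≤ d → 1 ≤ k → ∀ l : ℤ, IsCoprime (k : ℤ) l →
    |(∑ n ∈ dyadic N, if (n : ZMod k) = (l : ZMod k) ∧ n.Coprime d then β n else 0) -
        (∑ n ∈ dyadic N, if n.Coprime (d * k) then β n else 0) / (Nat.totient k : ℝ)| ≤
      C A * Real.sqrt (l2Sq N β) * N ^ (1 / 2 : ℝ) * (σ 0 d : ℝ) ^ B / Real.log (2 * N) ^ A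

/-- Hypothesis **(A₄)** of BFI §6 (p. 220: "`β_n = 0` if `n` has a prime factor `≤ N₀`"), for the
indices `n ∈ S`. [cite: BombieriFriedlanderIwaniecActa1986, §6 (A₄) p. 220] -/
def IsSifted (S : Finset ℕ) (N₀ : ℝ) (β : ℕ → ℝ) : Prop :=
  ∀ n ∈ S, (∃ p : ℕ, p.Prime ∧ p ∣ n ∧ (p : ℝ) ≤ N₀) → β n = 0

/-- The coefficients **(A₆*)** of BFI §12 (p. 237): `α_m = 1` if `(m, P(z)) = 1`, i.e. `m` has no
prime factor `p < z`, and `α_m = 0` otherwise (for `m ≥ 1`; stated through `Nat.primeFactors`, so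
that the junk value at `m = 0`, which never occurs in a range `m ∼ M`, is `1`).  For `z ≤ 2` this is
the constant `1` = (A₆) (p. 235). [cite: BombieriFriedlanderIwaniecActa1986, §12 (A₆*) p. 237] -/
noncomputable def roughIndicator (z : ℝ) (m : ℕ) : ℝ :=
  if ∀ p ∈ m.primeFactors, z ≤ (p : ℝ) then 1 else 0

/-- `roughIndicator z m ∈ {0, 1}`, in particular `|roughIndicator z m| ≤ 1`. [folklore] -/
theorem abs_roughIndicator_le_one (z : ℝ) (m : ℕ) : |roughIndicator z m| ≤ 1 := by
  unfold roughIndicator; split_ifs <;> simp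

/-- For `z ≤ 2` every `m` is `z`-rough: (A₆*) degenerates to (A₆), `α ≡ 1`. [folklore] -/
theorem roughIndicator_of_le_two {z : ℝ} (hz : z ≤ 2) (m : ℕ) : roughIndicator z m = 1 := by
  unfold roughIndicator
  rw [if_pos]
  intro p hp
  exact hz.trans (by exact_mod_cast (Nat.prime_of_mem_primeFactors hp).two_le)

/-- The four lower bounds for `M` in condition (12.5) of Theorem 5 (p. 237):
`max {Q, x⁻¹ Q R⁴, Q^{1/2} R, x⁻² Q³ R⁴}`. [cite: BombieriFriedlanderIwaniecActa1986, §12 (12.5) p. 237] -/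
noncomputable def thm5Threshold (x Q R : ℝ) : ℝ :=
  max (max Q (x⁻¹ * Q * R ^ 4)) (max (Q ^ (1 / 2 : ℝ) * R) (x ^ (-2 : ℝ) * Q ^ 3 * R ^ 4))

end BFI

open BFI

/-! ### Theorems 1 and 2 (bilinear forms, conclusion (3.3)) -/

/-- **Bombieri–Friedlander–Iwaniec 1986, Theorem 1** (§8, p. 225: "Suppose (A₁)–(A₄) hold. We then
have (3.3) provided `x^ε R < N < x^{−ε} min {x^{1/2} Q^{−1/2}, x² Q^{−5} R^{−1}, x Q^{−2} R^{−1/2}}`"),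
where (3.3) is `𝒢(M, N, Q, R) ≪ ‖β‖² x R^{−1} ℒ^{−A}` (p. 214, `ℒ = log x`, any `A > 0`).
Rendered with all dependencies explicit (see the module docstring): for `a ≠ 0`, `ε > 0`, `A > 0`,
a divisor exponent `B ≥ 0` and Siegel–Walfisz constants `Csw`, there are `B₀, C, x₀` such that for
`x ≥ x₀`, all `M N = x` with `x^ε ≤ N ≤ x^{1−ε}` (A₁), `Q, R ≥ 1/2` with `QR < x` (A₃) in the displayed
range, every real `β` with (A₂) (exponent `B`, constants `Csw`) and (A₄) (`β_n = 0` if `n ∼ N` has a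
prime factor `≤ ℒ^{B₀}`, (6.5)), and every real `γ` with `|γ_q| ≤ τ(q)^B` (A₃):
`𝒢(M,N,Q,R) ≤ C ‖β‖² x R⁻¹ ℒ^{−A}`.  A deep THEOREM (Linnik's dispersion method and the
Deshouillers–Iwaniec bounds for sums of Kloosterman sums, BFI §§3–8); not in Mathlib.
[cite: BombieriFriedlanderIwaniecActa1986, §8 Theorem 1 p. 225] -/
def BombieriFriedlanderIwaniecTheorem1 : Prop :=
  ∀ a : ℤ, a ≠ 0 → ∀ ε : ℝ, 0 < ε → ∀ A : ℝ, 0 < A → ∀ B : ℝ, 0 ≤ B → ∀ Csw : ℝ → ℝ,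
    ∃ B₀ C x₀ : ℝ, ∀ x : ℝ, x₀ ≤ x → ∀ M N Q R : ℝ,
      M * N = x → x ^ ε ≤ N → N ≤ x ^ (1 - ε) →
      1 / 2 ≤ Q → 1 / 2 ≤ R → Q * R < x →
      x ^ ε * R < N →
      N < x ^ (-ε) * (x ^ (1 / 2 : ℝ) * Q ^ (-(1 / 2) : ℝ)) →
      N < x ^ (-ε) * (x ^ 2 * Q ^ (-5 : ℝ) * R⁻¹) →
      N < x ^ (-ε) * (x * Q ^ (-2 : ℝ) * R ^ (-(1 / 2) : ℝ)) →
      ∀ β : ℕ → ℝ, SiegelWalfiszHyp N B Csw β → IsSifted (dyadic N) (Real.log x ^ B₀) β →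
      ∀ γ : ℕ → ℝ, (∀ q, |γ q| ≤ (σ 0 q : ℝ) ^ B) →
        dispG a M N Q R β γ ≤ C * l2Sq N β * x * R⁻¹ / Real.log x ^ A

/-- **Bombieri–Friedlander–Iwaniec 1986, Theorem 2** (§9, p. 230: "Suppose (A₁)–(A₅) hold. We then
have (3.3) provided `x^ε R < N < x^{−ε} min {(xR/Q²)^{1/2}, (x/Q)^{2/5}, (x²/Q³)^{1/4}}`").  As
Theorem 1, with the additional hypothesis (A₅) (p. 229): `N^{1−ε₅} ∑_{n∼N} β_n⁴ ≤ C₅ (∑_{n∼N} β_n²)²`,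
where the constant `C₅` is given and the exponent `ε₅ > 0` is provided by the theorem (it is chosen
after `a, ε, A, B, Csw, C₅`; see the module docstring for why this is the faithful reading of BFI's
floating `ε`).  A deep THEOREM (dispersion method, Deshouillers–Iwaniec, BFI §§3–7, 9); not in Mathlib.
[cite: BombieriFriedlanderIwaniecActa1986, §9 Theorem 2 p. 230] -/
def BombieriFriedlanderIwaniecTheorem2 : Prop :=
  ∀ a : ℤ, a ≠ 0 → ∀ ε : ℝ, 0 < ε → ∀ A : ℝ, 0 < A → ∀ B : ℝ, 0 ≤ B → ∀ Csw : ℝ → ℝ, ∀ C₅ : ℝ,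
    ∃ ε₅ B₀ C x₀ : ℝ, 0 < ε₅ ∧ ∀ x : ℝ, x₀ ≤ x → ∀ M N Q R : ℝ,
      M * N = x → x ^ ε ≤ N → N ≤ x ^ (1 - ε) →
      1 / 2 ≤ Q → 1 / 2 ≤ R → Q * R < x →
      x ^ ε * R < N →
      N < x ^ (-ε) * (x * R / Q ^ 2) ^ (1 / 2 : ℝ) →
      N < x ^ (-ε) * (x / Q) ^ (2 / 5 : ℝ) →
      N < x ^ (-ε) * (x ^ 2 / Q ^ 3) ^ (1 / 4 : ℝ) →
      ∀ β : ℕ → ℝ, SiegelWalfiszHyp N B Csw β → IsSifted (dyadic N) (Real.log x ^ B₀) β →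
      N ^ (1 - ε₅) * (∑ n ∈ dyadic N, β n ^ 4) ≤ C₅ * l2Sq N β ^ 2 →
      ∀ γ : ℕ → ℝ, (∀ q, |γ q| ≤ (σ 0 q : ℝ) ^ B) →
        dispG a M N Q R β γ ≤ C * l2Sq N β * x * R⁻¹ / Real.log x ^ A

/-- **The `𝒟`-form of Theorem 1** (BFI p. 214: (3.3) is designed so that, "by Cauchy's inequality",
`𝒟² ≤ ‖δ‖² ‖α‖² 𝒢`): under the hypotheses of `BombieriFriedlanderIwaniecTheorem1` and for ARBITRARY
real `α` (`m ∼ M`) and `δ` (`r ∼ R`),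
`𝒟(M,N,Q,R)² ≤ (∑_{r∼R} δ_r²)(∑_{m∼M} α_m²) · C ‖β‖² x R⁻¹ ℒ^{−A}`.  PROVED from the named fact and
`BFI.dispD_sq_le`. [cite: BombieriFriedlanderIwaniecActa1986, §3 (3.2)–(3.3) p. 214] -/
theorem BombieriFriedlanderIwaniecTheorem1.dispD_sq_bound (h : BombieriFriedlanderIwaniecTheorem1)
    {a : ℤ} (ha : a ≠ 0) {ε : ℝ} (hε : 0 < ε) {A : ℝ} (hA : 0 < A) {B : ℝ} (hB : 0 ≤ B)
    (Csw : ℝ → ℝ) :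
    ∃ B₀ C x₀ : ℝ, ∀ x : ℝ, x₀ ≤ x → ∀ M N Q R : ℝ,
      M * N = x → x ^ ε ≤ N → N ≤ x ^ (1 - ε) →
      1 / 2 ≤ Q → 1 / 2 ≤ R → Q * R < x →
      x ^ ε * R < N →
      N < x ^ (-ε) * (x ^ (1 / 2 : ℝ) * Q ^ (-(1 / 2) : ℝ)) →
      N < x ^ (-ε) * (x ^ 2 * Q ^ (-5 : ℝ) * R⁻¹) →
      N < x ^ (-ε) * (x * Q ^ (-2 : ℝ) * R ^ (-(1 / 2) : ℝ)) →
      ∀ β : ℕ → ℝ, SiegelWalfiszHyp N B Csw β → IsSifted (dyadic N) (Real.log x ^ B₀) β →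
      ∀ α γ δ : ℕ → ℝ, (∀ q, |γ q| ≤ (σ 0 q : ℝ) ^ B) →
        dispD a M N Q R α β γ δ ^ 2 ≤
          (∑ r ∈ dyadic R, δ r ^ 2) * (∑ m ∈ dyadic M, α m ^ 2) *
            (C * l2Sq N β * x * R⁻¹ / Real.log x ^ A) := by
  obtain ⟨B₀, C, x₀, hC⟩ := h a ha ε hε A hA B hB Csw
  refine ⟨B₀, C, x₀, fun x hx M N Q R hMN hN1 hN2 hQ hR hQR h1 h2 h3 h4 β hsw hsift α γ δ hγ => ?_⟩
  exact (dispD_sq_le a M N Q R α β γ δ).trans (mul_le_mul_of_nonneg_left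
    (hC x hx M N Q R hMN hN1 hN2 hQ hR hQR h1 h2 h3 h4 β hsw hsift γ hγ)
    (mul_nonneg (sum_nonneg fun _ _ => sq_nonneg _) (sum_nonneg fun _ _ => sq_nonneg _)))

/-- **The `𝒟`-form of Theorem 2**: under the hypotheses of `BombieriFriedlanderIwaniecTheorem2` and
for arbitrary real `α`, `δ`, `𝒟² ≤ (∑_{r∼R} δ_r²)(∑_{m∼M} α_m²) · C ‖β‖² x R⁻¹ ℒ^{−A}`.  PROVED from
the named fact and `BFI.dispD_sq_le`. [cite: BombieriFriedlanderIwaniecActa1986, §3 (3.2)–(3.3) p. 214] -/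
theorem BombieriFriedlanderIwaniecTheorem2.dispD_sq_bound (h : BombieriFriedlanderIwaniecTheorem2)
    {a : ℤ} (ha : a ≠ 0) {ε : ℝ} (hε : 0 < ε) {A : ℝ} (hA : 0 < A) {B : ℝ} (hB : 0 ≤ B)
    (Csw : ℝ → ℝ) (C₅ : ℝ) :
    ∃ ε₅ B₀ C x₀ : ℝ, 0 < ε₅ ∧ ∀ x : ℝ, x₀ ≤ x → ∀ M N Q R : ℝ,
      M * N = x → x ^ ε ≤ N → N ≤ x ^ (1 - ε) →
      1 / 2 ≤ Q → 1 / 2 ≤ R → Q * R < x →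
      x ^ ε * R < N →
      N < x ^ (-ε) * (x * R / Q ^ 2) ^ (1 / 2 : ℝ) →
      N < x ^ (-ε) * (x / Q) ^ (2 / 5 : ℝ) →
      N < x ^ (-ε) * (x ^ 2 / Q ^ 3) ^ (1 / 4 : ℝ) →
      ∀ β : ℕ → ℝ, SiegelWalfiszHyp N B Csw β → IsSifted (dyadic N) (Real.log x ^ B₀) β →
      N ^ (1 - ε₅) * (∑ n ∈ dyadic N, β n ^ 4) ≤ C₅ * l2Sq N β ^ 2 →
      ∀ α γ δ : ℕ → ℝ, (∀ q, |γ q| ≤ (σ 0 q : ℝ) ^ B) →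
        dispD a M N Q R α β γ δ ^ 2 ≤
          (∑ r ∈ dyadic R, δ r ^ 2) * (∑ m ∈ dyadic M, α m ^ 2) *
            (C * l2Sq N β * x * R⁻¹ / Real.log x ^ A) := by
  obtain ⟨ε₅, B₀, C, x₀, hε₅, hC⟩ := h a ha ε hε A hA B hB Csw C₅
  refine ⟨ε₅, B₀, C, x₀, hε₅,
    fun x hx M N Q R hMN hN1 hN2 hQ hR hQR h1 h2 h3 h4 β hsw hsift h5 α γ δ hγ => ?_⟩
  exact (dispD_sq_le a M N Q R α β γ δ).trans (mul_le_mul_of_nonneg_left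
    (hC x hx M N Q R hMN hN1 hN2 hQ hR hQR h1 h2 h3 h4 β hsw hsift h5 γ hγ)
    (mul_nonneg (sum_nonneg fun _ _ => sq_nonneg _) (sum_nonneg fun _ _ => sq_nonneg _)))

/-! ### Theorems 5 and 5* (special coefficients `α`, conclusion (12.4)) -/

/-- **Bombieri–Friedlander–Iwaniec 1986, Theorem 5** (§12, p. 237: "Let (A₁), (A₃) and (A₆) hold.
Let `a ≠ 0` and `ε > 0`. We then have (12.4) provided
`M > x^ε max {Q, x^{−1} Q R⁴, Q^{1/2} R, x^{−2} Q³ R⁴}` (12.5)"), where (A₆) is `α_m ≡ 1` (p. 235)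
and (12.4) is `𝒟(M, N, Q, R) ≪ ‖β‖ x^{1/2−ε} M^{1/2}` (p. 237).  Rendered: for `a ≠ 0`, `ε > 0` and
`B ≥ 0` there are `ε' > 0`, `C`, `x₀` such that for `x ≥ x₀`, all `M N = x` with
`x^ε ≤ N ≤ x^{1−ε}` (A₁), `Q, R ≥ 1/2`, `QR < x`, `x^ε · max{…} < M` (12.5), every real `β` and all
`γ, δ` with `|γ_q| ≤ τ(q)^B`, `|δ_r| ≤ τ(r)^B` (A₃):
`|𝒟(M,N,Q,R; α ≡ 1, β, γ, δ)| ≤ C ‖β‖ x^{1/2−ε'} M^{1/2}`.  (The saving exponent is existential: the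
print uses the same floating letter `ε` in (12.4) and (12.5).)  A deep THEOREM (Poisson summation and
the Deshouillers–Iwaniec bounds via Lemmas 6, 9); not in Mathlib.
[cite: BombieriFriedlanderIwaniecActa1986, §12 Theorem 5 p. 237] -/
def BombieriFriedlanderIwaniecTheorem5 : Prop :=
  ∀ a : ℤ, a ≠ 0 → ∀ ε : ℝ, 0 < ε → ∀ B : ℝ, 0 ≤ B →
    ∃ ε' C x₀ : ℝ, 0 < ε' ∧ ∀ x : ℝ, x₀ ≤ x → ∀ M N Q R : ℝ,
      M * N = x → x ^ ε ≤ N → N ≤ x ^ (1 - ε) →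
      1 / 2 ≤ Q → 1 / 2 ≤ R → Q * R < x →
      x ^ ε * thm5Threshold x Q R < M →
      ∀ β γ δ : ℕ → ℝ, (∀ q, |γ q| ≤ (σ 0 q : ℝ) ^ B) → (∀ r, |δ r| ≤ (σ 0 r : ℝ) ^ B) →
        |dispD a M N Q R (fun _ => 1) β γ δ| ≤
          C * Real.sqrt (l2Sq N β) * x ^ (1 / 2 - ε') * M ^ (1 / 2 : ℝ)

/-- **Bombieri–Friedlander–Iwaniec 1986, Theorem 5*** (§12, pp. 238–239: "Theorem 5 holds if (A₆) is
replaced by (A₆*) subject to `z ≤ z₀ = exp(log x / log log x)`"), where (A₆*) (p. 237) is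
`α_m = 1` if `(m, P(z)) = 1` and `α_m = 0` otherwise (`Literature.BFI.roughIndicator z`).  Conclusion as
PROVED on p. 238 (see the module docstring): a saving `ℒ^{−A}` for every `A > 0`, the
fundamental-lemma remainder `Δ(M,N;q) ≪ ℒ^{−A} Q^{−1} M ∑β_n` being only `ℒ^{−A}`-admissible.
Rendered: for `a ≠ 0`, `ε > 0`, `A > 0`, `B ≥ 0` there are `C, x₀` such that for `x ≥ x₀`, all
`M N = x` with `x^ε ≤ N ≤ x^{1−ε}`, `Q, R ≥ 1/2`, `QR < x`, `x^ε · max{…} < M` (12.5), every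
`z ≤ exp(log x / log log x)`, every real `β` and all `γ, δ` bounded by `τ^B` (A₃):
`|𝒟(M,N,Q,R; 1_{(·,P(z))=1}, β, γ, δ)| ≤ C ‖β‖ x^{1/2} M^{1/2} ℒ^{−A}`.  A deep THEOREM (Theorem 5 and
the fundamental lemma of the sieve, Lemma 4); not in Mathlib.
[cite: BombieriFriedlanderIwaniecActa1986, §12 Theorem 5* p. 238] -/
def BombieriFriedlanderIwaniecTheorem5Star : Prop :=
  ∀ a : ℤ, a ≠ 0 → ∀ ε : ℝ, 0 < ε → ∀ A : ℝ, 0 < A → ∀ B : ℝ, 0 ≤ B →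
    ∃ C x₀ : ℝ, ∀ x : ℝ, x₀ ≤ x → ∀ M N Q R : ℝ,
      M * N = x → x ^ ε ≤ N → N ≤ x ^ (1 - ε) →
      1 / 2 ≤ Q → 1 / 2 ≤ R → Q * R < x →
      x ^ ε * thm5Threshold x Q R < M →
      ∀ z : ℝ, z ≤ Real.exp (Real.log x / Real.log (Real.log x)) →
      ∀ β γ δ : ℕ → ℝ, (∀ q, |γ q| ≤ (σ 0 q : ℝ) ^ B) → (∀ r, |δ r| ≤ (σ 0 r : ℝ) ^ B) →
        |dispD a M N Q R (roughIndicator z) β γ δ| ≤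
          C * Real.sqrt (l2Sq N β) * x ^ (1 / 2 : ℝ) * M ^ (1 / 2 : ℝ) / Real.log x ^ A

end Literature.NumberTheory.Sieve
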